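import Summits.CriticalPhenomena.PercolationContinuityZ3.Theorems.PercNearOneGluingNoHeavyLowerTailAPLTreeFourPointMoments
import HarnessLib

/-!
# `NoHeavyLowerTail` (stmt-CriticalPhenomena-4575) — (T3′) summed over roots: `Var(Σ_K ℓ(K)²) ≤ (2/3)·(E Σ_K ℓ(K)⁴ − Σ_a ℓ_a (E ℓ(C_a))³)`,
# gen 39's tip inequality (P) `κ₃(L) + 3·Cov(L,R) ≤ 0` verbatim, and the event-level corollaries of (T3′)

Support file (prover prim-ineq-gen-8 gen 40; `--supports stmt-CriticalPhenomena-4575`; memo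
run/shared/lean/prim/prim-ineq-gen-8/FINDING-gen40-T3.md §0(3)).  No definitions, no named facts, no sorries.

`μ = prodBernoulli w` on the pairs of a finite vertex type `V`; loads `ℓ ≥ 0`; `L_a = Σ_u ℓ_u 1[a↔u]` (load of the cluster of `a`),
`S₂ = Σ_{a,u} ℓ_a ℓ_u 1[a↔u] = Σ_K ℓ(K)²`, `Σ_a ℓ_a L_a³ = Σ_K ℓ(K)⁴`.  Summing `APL.cov_load_S2_le` (`3·Cov(L_a,S₂) ≤ 2(EL_a³ − (EL_a)³)`)
over the roots `a` with weights `ℓ_a` and using `Σ_a ℓ_a L_a = S₂`: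
* **`var_S2_le`** — `3·(E[S₂²] − E[S₂]²) ≤ 2·(E[Σ_a ℓ_a L_a³] − Σ_a ℓ_a E[L_a]³)`; unit loads: `Var(Σ_K|K|²) ≤ (2/3)(E Σ_K|K|⁴ − Σ_a χ_a³)`,
  `χ_a = E|C_a|` — gen 39's cluster-size fluctuation inequality (memo FINDING-gen39-TE-CORES.md §0(5); asymptotically sharp on
  near-critical Erdős–Rényi graphs, `Var S₂ / E S₄ → 2/3`), now an elementary consequence of the four-point tree inequality (T3′);
* **`kappa3_add_three_cov_nonpos`** — gen 39's (P) verbatim: `κ₃(L) + 3·Cov(L, R) ≤ 0` with `R = S₂ − L²` (the squared loads of the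
  clusters other than that of `a`), `κ₃(L) = EL³ − 3·EL·EL² + 2(EL)³` — the third-order coefficient of the tree-envelope defect at the
  sparse tip (gen 39 §3(c)), for every finite weighted graph;
* `fourPoint_even_le_matchings` — the percolation LEBOWITZ inequality `P(even) ≤ Σ_{matchings} P(·↔·)P(·↔·)` (weak form of (T3′));
* `treeFourPoint_cov` — the covariance form `Σ_{3 matchings} Cov(1[a↔y], 1[z↔z']) + 2τ_uτ_vτ_x ≤ 2·P(a↔u,a↔v,a↔x)`.
[this work]
-/

noncomputable section

namespace Summit.CriticalPhenomena.PercolationContinuityZ3.Theorems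

namespace APL

open MeasureTheory Set Literature.Probability.Percolation Literature.Probability.LatticeModels
open scoped Classical

variable {V : Type*}

/-! ### Summed over roots: `3·Var(S₂) ≤ 2·(E S₄ − Σ_a ℓ_a (E L_a)³)` -/

section Variance

variable [Fintype V]

/-- `Σ_a ℓ_a · L_a = S₂` pointwise (`L_a = Σ_u ℓ_u 1[a↔u]`, `S₂ = Σ_{a,u} ℓ_a ℓ_u 1[a↔u]`). [folklore] -/
theorem sum_load_mul_load (ℓ : V → ℝ) (ω : BondConfig V) :
    ∑ a, ℓ a * (∑ u, ℓ u * (openConn a u : Set (BondConfig V)).indicator 1 ω) =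
      ∑ a, ∑ u, ℓ a * ℓ u * (openConn a u : Set (BondConfig V)).indicator 1 ω := by
  refine Finset.sum_congr rfl fun a _ => ?_
  rw [Finset.mul_sum]
  refine Finset.sum_congr rfl fun u _ => ?_
  ring

/-- **THE VARIANCE OF `S₂ = Σ_K ℓ(K)²` on every finite weighted graph** (gen 39's headline inequality, now from (T3′)):
with `L_a = Σ_u ℓ_u 1[a↔u]` and `S₂ = Σ_{a,u} ℓ_a ℓ_u 1[a↔u]`, for all loads `ℓ ≥ 0`,
`3·(E[S₂²] − E[S₂]²) ≤ 2·(E[Σ_a ℓ_a L_a³] − Σ_a ℓ_a·E[L_a]³)`; for unit loads `E[Σ_a L_a³] = E Σ_K |K|⁴` and `E[L_a] = χ_a`, i.e.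
`Var(Σ_K |K|²) ≤ (2/3)·(E Σ_K |K|⁴ − Σ_a χ_a³)` (sharp: near-critical Erdős–Rényi graphs, gen 39 §0(5)). [this work] -/
theorem var_S2_le (w : Sym2 V → unitInterval) (ℓ : V → ℝ) (hℓ : ∀ y, 0 ≤ ℓ y) :
    3 * ((∫ ω, (∑ a, ∑ u, ℓ a * ℓ u * (openConn a u : Set (BondConfig V)).indicator 1 ω) ^ 2 ∂(prodBernoulli w))
          - (∫ ω, ∑ a, ∑ u, ℓ a * ℓ u * (openConn a u : Set (BondConfig V)).indicator 1 ω ∂(prodBernoulli w)) ^ 2) ≤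
      2 * ((∫ ω, ∑ a, ℓ a * (∑ u, ℓ u * (openConn a u : Set (BondConfig V)).indicator 1 ω) ^ 3 ∂(prodBernoulli w))
          - ∑ a, ℓ a * (∫ ω, ∑ u, ℓ u * (openConn a u : Set (BondConfig V)).indicator 1 ω ∂(prodBernoulli w)) ^ 3) := by
  -- sum the per-root inequalities with weights `ℓ a`
  have hsum := Finset.sum_le_sum fun a (_ : a ∈ (Finset.univ : Finset V)) =>
    mul_le_mul_of_nonneg_left (cov_load_S2_le w a ℓ hℓ) (hℓ a)
  -- name the pieces
  have eLS : ∀ a, ℓ a * ∫ ω, (∑ u, ℓ u * (openConn a u : Set (BondConfig V)).indicator 1 ω)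
        * (∑ v, ∑ x, ℓ v * ℓ x * (openConn v x : Set (BondConfig V)).indicator 1 ω) ∂(prodBernoulli w) =
      ∫ ω, ℓ a * ((∑ u, ℓ u * (openConn a u : Set (BondConfig V)).indicator 1 ω)
        * (∑ v, ∑ x, ℓ v * ℓ x * (openConn v x : Set (BondConfig V)).indicator 1 ω)) ∂(prodBernoulli w) :=
    fun a => (integral_const_mul _ _).symm
  have eL : ∀ a, ℓ a * ∫ ω, ∑ u, ℓ u * (openConn a u : Set (BondConfig V)).indicator 1 ω ∂(prodBernoulli w) =
      ∫ ω, ℓ a * (∑ u, ℓ u * (openConn a u : Set (BondConfig V)).indicator 1 ω) ∂(prodBernoulli w) :=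
    fun a => (integral_const_mul _ _).symm
  have eL3 : ∀ a, ℓ a * ∫ ω, (∑ u, ℓ u * (openConn a u : Set (BondConfig V)).indicator 1 ω) ^ 3 ∂(prodBernoulli w) =
      ∫ ω, ℓ a * (∑ u, ℓ u * (openConn a u : Set (BondConfig V)).indicator 1 ω) ^ 3 ∂(prodBernoulli w) :=
    fun a => (integral_const_mul _ _).symm
  -- Σ_a ℓ_a E[L_a S₂] = E[S₂²]
  have h1 : ∑ a, ℓ a * ∫ ω, (∑ u, ℓ u * (openConn a u : Set (BondConfig V)).indicator 1 ω)
        * (∑ v, ∑ x, ℓ v * ℓ x * (openConn v x : Set (BondConfig V)).indicator 1 ω) ∂(prodBernoulli w) =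
      ∫ ω, (∑ a, ∑ u, ℓ a * ℓ u * (openConn a u : Set (BondConfig V)).indicator 1 ω) ^ 2 ∂(prodBernoulli w) := by
    simp_rw [eLS]
    rw [← integral_finsetSum _ (fun a _ => Integrable.of_finite)]
    refine integral_congr_ae (ae_of_all _ fun ω => ?_)
    have hassoc : ∀ i : V, ℓ i * ((∑ u, ℓ u * (openConn i u : Set (BondConfig V)).indicator 1 ω)
        * (∑ v, ∑ x, ℓ v * ℓ x * (openConn v x : Set (BondConfig V)).indicator 1 ω)) =
        (ℓ i * (∑ u, ℓ u * (openConn i u : Set (BondConfig V)).indicator 1 ω))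
        * (∑ v, ∑ x, ℓ v * ℓ x * (openConn v x : Set (BondConfig V)).indicator 1 ω) := fun i => by ring
    simp only
    rw [Finset.sum_congr rfl fun i (_ : i ∈ Finset.univ) => hassoc i, ← Finset.sum_mul, sum_load_mul_load, pow_two]
  -- Σ_a ℓ_a E[L_a] = E[S₂]
  have h2 : ∑ a, ℓ a * ∫ ω, ∑ u, ℓ u * (openConn a u : Set (BondConfig V)).indicator 1 ω ∂(prodBernoulli w) =
      ∫ ω, ∑ a, ∑ u, ℓ a * ℓ u * (openConn a u : Set (BondConfig V)).indicator 1 ω ∂(prodBernoulli w) := by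
    simp_rw [eL]
    rw [← integral_finsetSum _ (fun a _ => Integrable.of_finite)]
    refine integral_congr_ae (ae_of_all _ fun ω => ?_)
    simp only
    exact sum_load_mul_load ℓ ω
  -- Σ_a ℓ_a E[L_a³] = E[Σ_a ℓ_a L_a³]
  have h3 : ∑ a, ℓ a * ∫ ω, (∑ u, ℓ u * (openConn a u : Set (BondConfig V)).indicator 1 ω) ^ 3 ∂(prodBernoulli w) =
      ∫ ω, ∑ a, ℓ a * (∑ u, ℓ u * (openConn a u : Set (BondConfig V)).indicator 1 ω) ^ 3 ∂(prodBernoulli w) := by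
    simp_rw [eL3]
    rw [← integral_finsetSum _ (fun a _ => Integrable.of_finite)]
  -- assemble
  have e : ∀ a : V,
      ℓ a * (3 * ((∫ ω, (∑ u, ℓ u * (openConn a u : Set (BondConfig V)).indicator 1 ω)
              * (∑ v, ∑ x, ℓ v * ℓ x * (openConn v x : Set (BondConfig V)).indicator 1 ω) ∂(prodBernoulli w))
          - (∫ ω, ∑ u, ℓ u * (openConn a u : Set (BondConfig V)).indicator 1 ω ∂(prodBernoulli w))
            * (∫ ω, ∑ v, ∑ x, ℓ v * ℓ x * (openConn v x : Set (BondConfig V)).indicator 1 ω ∂(prodBernoulli w)))) =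
      3 * (ℓ a * ∫ ω, (∑ u, ℓ u * (openConn a u : Set (BondConfig V)).indicator 1 ω)
              * (∑ v, ∑ x, ℓ v * ℓ x * (openConn v x : Set (BondConfig V)).indicator 1 ω) ∂(prodBernoulli w))
        - 3 * (ℓ a * ∫ ω, ∑ u, ℓ u * (openConn a u : Set (BondConfig V)).indicator 1 ω ∂(prodBernoulli w))
            * (∫ ω, ∑ v, ∑ x, ℓ v * ℓ x * (openConn v x : Set (BondConfig V)).indicator 1 ω ∂(prodBernoulli w)) := by
    intro a; ring
  have e' : ∀ a : V,
      ℓ a * (2 * ((∫ ω, (∑ u, ℓ u * (openConn a u : Set (BondConfig V)).indicator 1 ω) ^ 3 ∂(prodBernoulli w))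
          - (∫ ω, ∑ u, ℓ u * (openConn a u : Set (BondConfig V)).indicator 1 ω ∂(prodBernoulli w)) ^ 3)) =
      2 * (ℓ a * ∫ ω, (∑ u, ℓ u * (openConn a u : Set (BondConfig V)).indicator 1 ω) ^ 3 ∂(prodBernoulli w))
        - 2 * (ℓ a * (∫ ω, ∑ u, ℓ u * (openConn a u : Set (BondConfig V)).indicator 1 ω ∂(prodBernoulli w)) ^ 3) := by
    intro a; ring
  rw [Finset.sum_congr rfl fun a (_ : a ∈ Finset.univ) => e a, Finset.sum_congr rfl fun a (_ : a ∈ Finset.univ) => e' a] at hsum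
  simp only [Finset.sum_sub_distrib, ← Finset.mul_sum, ← Finset.sum_mul] at hsum
  rw [h1, h2, h3] at hsum
  rw [pow_two ((∫ ω, ∑ a, ∑ u, ℓ a * ℓ u * (openConn a u : Set (BondConfig V)).indicator 1 ω ∂(prodBernoulli w)))]
  linarith

end Variance

/-! ### The cumulant form (P): `κ₃(L) + 3·Cov(L, R) ≤ 0`, `R = S₂ − L²` -/

section Cumulant

variable [Fintype V]

/-- **gen 39's (P) verbatim: `κ₃(L) + 3·Cov(L, R) ≤ 0`** for every finite weighted graph, root `a` and loads `ℓ ≥ 0`, where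
`L = Σ_u ℓ_u 1[a↔u]` is the load of the cluster of `a`, `R = S₂ − L²` the sum of the squared loads of the OTHER clusters,
`κ₃(L) = E L³ − 3·E L·E L² + 2(E L)³`.  (Equivalent to `cov_load_S2_le` by expanding `R = S₂ − L²`.) [this work] -/
theorem kappa3_add_three_cov_nonpos (w : Sym2 V → unitInterval) (a : V) (ℓ : V → ℝ) (hℓ : ∀ y, 0 ≤ ℓ y) :
    (∫ ω, (∑ u, ℓ u * (openConn a u : Set (BondConfig V)).indicator 1 ω) ^ 3 ∂(prodBernoulli w))
      - 3 * (∫ ω, ∑ u, ℓ u * (openConn a u : Set (BondConfig V)).indicator 1 ω ∂(prodBernoulli w))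
          * (∫ ω, (∑ u, ℓ u * (openConn a u : Set (BondConfig V)).indicator 1 ω) ^ 2 ∂(prodBernoulli w))
      + 2 * (∫ ω, ∑ u, ℓ u * (openConn a u : Set (BondConfig V)).indicator 1 ω ∂(prodBernoulli w)) ^ 3
      + 3 * ((∫ ω, (∑ u, ℓ u * (openConn a u : Set (BondConfig V)).indicator 1 ω)
                * ((∑ v, ∑ x, ℓ v * ℓ x * (openConn v x : Set (BondConfig V)).indicator 1 ω)
                  - (∑ u, ℓ u * (openConn a u : Set (BondConfig V)).indicator 1 ω) ^ 2) ∂(prodBernoulli w))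
            - (∫ ω, ∑ u, ℓ u * (openConn a u : Set (BondConfig V)).indicator 1 ω ∂(prodBernoulli w))
              * (∫ ω, ((∑ v, ∑ x, ℓ v * ℓ x * (openConn v x : Set (BondConfig V)).indicator 1 ω)
                  - (∑ u, ℓ u * (openConn a u : Set (BondConfig V)).indicator 1 ω) ^ 2) ∂(prodBernoulli w))) ≤ 0 := by
  have hmain := cov_load_S2_le w a ℓ hℓ
  -- linearity of the two integrals involving `R = S₂ − L²`
  have e1 : (∫ ω, (∑ u, ℓ u * (openConn a u : Set (BondConfig V)).indicator 1 ω)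
        * ((∑ v, ∑ x, ℓ v * ℓ x * (openConn v x : Set (BondConfig V)).indicator 1 ω)
          - (∑ u, ℓ u * (openConn a u : Set (BondConfig V)).indicator 1 ω) ^ 2) ∂(prodBernoulli w)) =
      (∫ ω, (∑ u, ℓ u * (openConn a u : Set (BondConfig V)).indicator 1 ω)
          * (∑ v, ∑ x, ℓ v * ℓ x * (openConn v x : Set (BondConfig V)).indicator 1 ω) ∂(prodBernoulli w))
        - (∫ ω, (∑ u, ℓ u * (openConn a u : Set (BondConfig V)).indicator 1 ω) ^ 3 ∂(prodBernoulli w)) := by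
    rw [← integral_sub Integrable.of_finite Integrable.of_finite]
    refine integral_congr_ae (ae_of_all _ fun ω => ?_)
    simp only
    ring
  have e2 : (∫ ω, ((∑ v, ∑ x, ℓ v * ℓ x * (openConn v x : Set (BondConfig V)).indicator 1 ω)
        - (∑ u, ℓ u * (openConn a u : Set (BondConfig V)).indicator 1 ω) ^ 2) ∂(prodBernoulli w)) =
      (∫ ω, ∑ v, ∑ x, ℓ v * ℓ x * (openConn v x : Set (BondConfig V)).indicator 1 ω ∂(prodBernoulli w))
        - (∫ ω, (∑ u, ℓ u * (openConn a u : Set (BondConfig V)).indicator 1 ω) ^ 2 ∂(prodBernoulli w)) :=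
    integral_sub Integrable.of_finite Integrable.of_finite
  rw [e1, e2]
  nlinarith [hmain]

end Cumulant

/-! ### Corollaries of (T3′): the percolation Lebowitz inequality and the covariance form -/

section Corollaries

variable [Fintype V]

/-- **The percolation Lebowitz inequality (weak form of (T3′)).**  For all `a, u, v, x`:
`P(a↔u,a↔v,a↔x) + P(a↔u,a↮v,v↔x) + P(a↔v,a↮u,u↔x) + P(a↔x,a↮u,u↔v) ≤ P(a↔u)P(v↔x) + P(a↔v)P(u↔x) + P(a↔x)P(u↔v)`, i.e.
`P(every cluster contains an even number of the four points) ≤ Σ_{perfect matchings} P(·↔·)P(·↔·)` — the analogue of Lebowitz'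
`u₄ ≤ 0`; it also follows from the van den Berg–Kesten inequality, (T3′) sharpens it by the tree term `2P(a↔u)P(a↔v)P(a↔x)`. [this work] -/
theorem fourPoint_even_le_matchings (w : Sym2 V → unitInterval) (a u v x : V) :
    (prodBernoulli w).real (openConn a u ∩ openConn a v ∩ openConn a x : Set (BondConfig V))
        + (prodBernoulli w).real (openConn a u ∩ (openConn a v)ᶜ ∩ openConn v x : Set (BondConfig V))
        + (prodBernoulli w).real (openConn a v ∩ (openConn a u)ᶜ ∩ openConn u x : Set (BondConfig V))
        + (prodBernoulli w).real (openConn a x ∩ (openConn a u)ᶜ ∩ openConn u v : Set (BondConfig V)) ≤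
      (prodBernoulli w).real (openConn a u : Set (BondConfig V)) * (prodBernoulli w).real (openConn v x : Set (BondConfig V))
        + (prodBernoulli w).real (openConn a v : Set (BondConfig V)) * (prodBernoulli w).real (openConn u x : Set (BondConfig V))
        + (prodBernoulli w).real (openConn a x : Set (BondConfig V)) * (prodBernoulli w).real (openConn u v : Set (BondConfig V)) := by
  have h := treeFourPoint_all w a u v x
  have h0 : 0 ≤ 2 * (prodBernoulli w).real (openConn a u : Set (BondConfig V)) * (prodBernoulli w).real (openConn a v : Set (BondConfig V))
      * (prodBernoulli w).real (openConn a x : Set (BondConfig V)) :=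
    mul_nonneg (mul_nonneg (mul_nonneg (by norm_num) measureReal_nonneg) measureReal_nonneg) measureReal_nonneg
  linarith

/-- **Covariance form of (T3′).**  For all `a, u, v, x`:
`Σ_{3 matchings} [P(a↔y, z↔z') − P(a↔y)·P(z↔z')] + 2·P(a↔u)P(a↔v)P(a↔x) ≤ 2·P(a↔u, a↔v, a↔x)`,
i.e. the three covariances `Cov(1[a↔y], 1[z↔z'])` plus the tree term are at most twice the four-point connection probability. [this work] -/
theorem treeFourPoint_cov (w : Sym2 V → unitInterval) (a u v x : V) :
    ((prodBernoulli w).real (openConn a u ∩ openConn v x : Set (BondConfig V))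
        - (prodBernoulli w).real (openConn a u : Set (BondConfig V)) * (prodBernoulli w).real (openConn v x : Set (BondConfig V)))
      + ((prodBernoulli w).real (openConn a v ∩ openConn u x : Set (BondConfig V))
        - (prodBernoulli w).real (openConn a v : Set (BondConfig V)) * (prodBernoulli w).real (openConn u x : Set (BondConfig V)))
      + ((prodBernoulli w).real (openConn a x ∩ openConn u v : Set (BondConfig V))
        - (prodBernoulli w).real (openConn a x : Set (BondConfig V)) * (prodBernoulli w).real (openConn u v : Set (BondConfig V)))
      + 2 * (prodBernoulli w).real (openConn a u : Set (BondConfig V)) * (prodBernoulli w).real (openConn a v : Set (BondConfig V))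
          * (prodBernoulli w).real (openConn a x : Set (BondConfig V)) ≤
      2 * (prodBernoulli w).real (openConn a u ∩ openConn a v ∩ openConn a x : Set (BondConfig V)) := by
  have h := treeFourPoint_all w a u v x
  have s1 := real_conn_inter_conn_split w a u v x
  have s2 := real_conn_inter_conn_split w a v u x
  have s3 := real_conn_inter_conn_split w a x u v
  have e2 : (openConn a v ∩ openConn a u ∩ openConn a x : Set (BondConfig V)) =
      (openConn a u ∩ openConn a v ∩ openConn a x : Set (BondConfig V)) := by
    rw [Set.inter_comm (openConn a v : Set (BondConfig V)) (openConn a u)]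
  have e3 : (openConn a x ∩ openConn a u ∩ openConn a v : Set (BondConfig V)) =
      (openConn a u ∩ openConn a v ∩ openConn a x : Set (BondConfig V)) := by
    rw [Set.inter_comm (openConn a x : Set (BondConfig V)) (openConn a u), Set.inter_right_comm]
  rw [e2] at s2
  rw [e3] at s3
  linarith

end Corollaries

end APL

end Summit.CriticalPhenomena.PercolationContinuityZ3.Theorems

end
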